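/-
Copyright (c) 2026 the pub-hodgecm-mathlib formalisation cell (harness21).  Prover seat hodgecm-mathlib-K2E2-p13 (g3), HCML Track B «K2-LIT» (build stream 29),
h413 = `stmt-HodgeConjecture-24833`, line `K2_E3_EllipticInputs`, unit U12 «Characters», socket #11 road (11-SC), letter (SC-an), road «FC» (finite conjugation
measure), brick (FC-5b) «TORUS AVERAGING — STEP (v) PACKAGED» over ★ (FC-5) p857212 ((SC-an) lead K2E3-p14 (g4) RULINGS #15 (R15-1)(v) ∕ #18 (iv) CURRENCY RULING (λ×);
offer `K2/STATUS.md` 2026-09-04T04:02Z).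
-/
import Summits.HodgeConjecture.HodgeConjecture.Theorems.K2E3DiagonalCollisionMeasure   -- ★ (FC-5) p857212 (this seat): `torusOne_mem_unitaryGroupOfForm`, `measure_diagCollision_unitary_le_of_unitsDigitFibre`
import Literature.NumberTheory.Automorphic.NormOneTorusAdelicCompact                    -- ★ `continuous_glDiagonal` (`d ↦ diag(d)` is continuous for the units topologies)
import Literature.NumberTheory.Automorphic.LocalFieldHaarBalls                          -- ★ `LocalFieldHaar.continuous_normAbs` (`‖·‖_K` is continuous)
import Mathlib.MeasureTheory.Group.LIntegral
import Mathlib.MeasureTheory.Measure.Prod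
import Mathlib.Topology.Instances.Matrix
import HarnessLib

/-!
# h413 ∕ Track B «K2-LIT», (SC-an) line, road «FC» — brick (FC-5b): TORUS AVERAGING, AND STEP (v) «`μ(B ∩ {near-collision}) ≤ C·(ε∕ρ)^κ·μ(B)`» PACKAGED
# (Harish-Chandra 1970, Part VII §2 p. 69; Rogawski 1990, §1.10 p. 9)

Cell `pub/hodgecm-mathlib`, Track B «K2-LIT», crux H413 = `stmt-HodgeConjecture-24833` (lane `--supports … --as helper`, count-neutral).  THEOREMS ONLY (no `def`,
no `instance`, no `notation`, no named-fact hypothesis, no `sorry`).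

WHERE THIS SITS.  Step (v) of road «FC» ((SC-an) lead K2E3-p14 (g4), MAP v5 (R15-1); consumer ★∕(FC-8) `K2E3FinConjRankOne` F3, K2E3-p23 (g4)): for a measurable set
`B ⊆ U = U(σ, Φ₃)(K)` invariant under the compact one-parameter torus `t_a = diag(a, 1, σ(a)⁻¹)`, `a ∈ 𝒪^× = {valuation = 1} ⊆ Kˣ` (`box_d ∩ Zc` in the line's notation),
«`μ(B ∩ {near-collision at scale ε}) ≤ μ(B) · sup_{g ∈ B} λ×{a : t_a g collides} ≤ μ(B) · C · (ε∕ρ)^κ`».  CURRENCY RULING (λ×) (RULINGS #18 (iv)): `λ×` is a Haar measure `μ'`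
of `Kˣ` read on the unit sphere — NOT a probability on a subgroup `↥T'`; accordingly THIS FILE averages directly over `a ∈ 𝒪^×` by Tonelli on `Kˣ × ↥U` and the left
invariance of `μ`, with NO subgroup, NO Haar measure on `↥T'`, NO normalisation (★ (FC-C) `K2E3CompactSubgroupAveraging` is the subgroup∕probability form of the same step):
* §1 GENERIC AVERAGING over a family `τ : A → G` of left translations preserving `B` (`G` a measurable group with a left-invariant `SFinite` measure `μ`, `A` any measurable
  space with an `SFinite` measure `μ'`, `S ⊆ A` measurable, `τ a • B = B` for `a ∈ S`): `setLIntegral_comp_mul_left_eq` (`∫_B f(τ_a x) = ∫_B f`),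
  **`measure_mul_setLIntegral_eq_setLIntegral_setLIntegral`** (`μ'(S) · ∫_B f = ∫_B ∫_S f(τ_a x) dμ'(a) dμ(x)`), **`measure_mul_setLIntegral_le_measure_mul_iSup`**
  (`μ'(S) · ∫_B f ≤ μ(B) · sup_{x ∈ B} ∫_S f(τ_a x) dμ'(a)`).
* §2 THE TORUS MAP `a ↦ t_a : Kˣ → ↥U` (★ (FC-5) `torusOne_mem_unitaryGroupOfForm`): `torusOne_mul` (a homomorphism), **`continuous_torusOne`** (★ `continuous_glDiagonal`,
  `σ` continuous), and the measurability of the near-collision event `{g | ∃ i ≠ j, |g_ii − g_jj| ≤ ε}` (closed) and of its torus fibres.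
* §3 STEP (v): **`unitSphere_mul_measure_inter_nearCollision_le_iSup`** (`μ'(𝒪^×) · μ(B ∩ NearColl_ε) ≤ μ(B) · sup_{g ∈ B} μ'{a ∈ 𝒪^× : t_a g collides}`, any measurable
  `𝒪^×`-invariant `B`) and, over ★ (FC-5) §5 ∕ (FC-D)'s frozen head `hD`, **`measure_inter_nearCollision_le_of_unitsDigitFibre`**: `∃ κ > 0, ∃ C ≠ ⊤, ∀ ρ > 0, ∀ ε, ∀ B`
  measurable, `𝒪^×`-invariant, with `ρ ≤ |g₀₀|, |g₁₁|` on `B`: `μ'(𝒪^×) · μ(B ∩ NearColl_ε) ≤ C · (ε∕ρ)^κ · μ'(𝒪^×) · μ(B)`; and the cancelled form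
  **`measure_inter_nearCollision_le_of_unitsDigitFibre'`** (`0 < μ'(𝒪^×) < ⊤ ⇒ μ(B ∩ NearColl_ε) ≤ C · (ε∕ρ)^κ · μ(B)`) — the line's «`μ(box_d ∩ {near-collision}) ≤
  μ(box_d) · C_M · s_d^κ`» token for token.
Frame: `K` a non-archimedean local field in the `ValuativeRel` currency of (FC-D) (`[Field K] [ValuativeRel K] [TopologicalSpace K] [IsNonarchimedeanLocalField K]`), `σ` an
involution (`hσ`) that is continuous (`hσc`) and isometric (`hσn`); `[MeasurableSpace Kˣ] [BorelSpace Kˣ]` and `[MeasurableSpace ↥U] [BorelSpace ↥U] [SecondCountableTopology ↥U]`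
as BINDERS (either instance convention for `Kˣ` docks); `μ` left-invariant `SFinite` on `↥U` (Haar ⇒), `μ'` `SFinite` on `Kˣ` (Haar ⇒).

HONEST LABEL: HC_CM is proved only modulo the 7 printed citations (2 remaining named inputs: hLiu418 = `stmt-HodgeConjecture-24832`, h413 =
`stmt-HodgeConjecture-24833`) until rung 0 closes; count-neutral helper (Tonelli + a union bound; nothing printed is asserted as a fact); §3's second theorem is
conditional on (FC-D) through `hD` until that file lands.

## References
* [HarishChandra1970] Harish-Chandra (notes by G. van Dijk), *Harmonic Analysis on Reductive p-adic Groups*, LNM 162 (1970), Part VII §2 p. 69; Part VI §8 Thm 14 p. 60.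
* [Rogawski1990] J. D. Rogawski, *Automorphic Representations of Unitary Groups in Three Variables*, Ann. of Math. Stud. 123 (1990), §1.10 p. 9 (`M = {d(α, β, ᾱ⁻¹)}`).
* [WeilIntegration1965] A. Weil, *L'intégration dans les groupes topologiques et ses applications* (2nd ed., 1965), §7 (invariant integration, Fubini on `G × G`).
-/

set_option autoImplicit false
set_option linter.dupNamespace false  -- the mandated namespace repeats the single-problem summit's segment (`HodgeConjecture.HodgeConjecture`)

noncomputable section

open MeasureTheory Set ValuativeRel Function Literature.NumberTheory.Automorphic Literature.NumberTheory.Automorphic.UnitaryGroup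
open Literature.NumberTheory.GaloisRepresentations Literature.NumberTheory.GaloisRepresentations.IsNonarchimedeanLocalField
open Summit.HodgeConjecture.HodgeConjecture.Cruxes.H413.K2E3DiagonalCollisionMeasure
open scoped NNReal ENNReal MatrixGroups Pointwise

namespace Summit.HodgeConjecture.HodgeConjecture.Cruxes.H413.K2E3TorusOneAveraging

/-! ## §1 Generic averaging over a family of `B`-preserving left translations -/

section Generic
variable {G : Type*} [Group G] [MeasurableSpace G] [MeasurableMul G] (μ : Measure G) [μ.IsMulLeftInvariant]
  {A : Type*} (τ : A → G) {S : Set A} {B : Set G} (hBm : MeasurableSet B) (hB : ∀ a ∈ S, τ a • B = B)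

include hBm hB in
/-- **`∫_B f(τ_a x) dμ(x) = ∫_B f dμ`** for `a ∈ S`: left invariance of `μ` and `τ_a • B = B` (`1_B(x) f(τ_a x) = (1_B f)(τ_a x)`). [cite: WeilIntegration1965, §7] -/
theorem setLIntegral_comp_mul_left_eq {a : A} (ha : a ∈ S) (f : G → ℝ≥0∞) :
    ∫⁻ x in B, f (τ a * x) ∂μ = ∫⁻ x in B, f x ∂μ := by
  have hmem : ∀ x, τ a * x ∈ B ↔ x ∈ B := fun x => by
    conv_lhs => rw [← hB a ha]
    exact smul_mem_smul_set_iff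
  have hind : (fun x => B.indicator f (τ a * x)) = B.indicator (fun x => f (τ a * x)) := by
    funext x
    by_cases hx : x ∈ B
    · rw [indicator_of_mem hx, indicator_of_mem ((hmem x).2 hx)]
    · rw [indicator_of_notMem hx, indicator_of_notMem (fun h => hx ((hmem x).1 h))]
  rw [← lintegral_indicator hBm, ← lintegral_indicator hBm, ← hind, lintegral_mul_left_eq_self]

include hBm hB in
/-- **THE AVERAGING IDENTITY**: `μ'(S) · ∫_B f dμ = ∫_B ∫_S f(τ_a x) dμ'(a) dμ(x)` (integrate `setLIntegral_comp_mul_left_eq` over `a ∈ S`, then Tonelli on `A × G`).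
[cite: WeilIntegration1965, §7] -/
theorem measure_mul_setLIntegral_eq_setLIntegral_setLIntegral [SFinite μ] [MeasurableSpace A] (μ' : Measure A) [SFinite μ'] (hSm : MeasurableSet S)
    {f : G → ℝ≥0∞} (hF : Measurable fun p : A × G => f (τ p.1 * p.2)) :
    μ' S * ∫⁻ x in B, f x ∂μ = ∫⁻ x in B, ∫⁻ a in S, f (τ a * x) ∂μ' ∂μ := by
  have h1 : ∫⁻ a in S, ∫⁻ x in B, f (τ a * x) ∂μ ∂μ' = ∫⁻ _ in S, ∫⁻ x in B, f x ∂μ ∂μ' :=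
    setLIntegral_congr_fun hSm fun a ha => setLIntegral_comp_mul_left_eq μ τ hBm hB ha f
  rw [setLIntegral_const, mul_comm] at h1
  rw [← h1]
  exact lintegral_lintegral_swap (hF.aemeasurable)

include hBm hB in
/-- **THE AVERAGING BOUND**: `μ'(S) · ∫_B f dμ ≤ μ(B) · sup_{x ∈ B} ∫_S f(τ_a x) dμ'(a)` (the un-normalised form of ★ (FC-C) (ii) for a family of translations indexed by a
measure space). [cite: WeilIntegration1965, §7] -/
theorem measure_mul_setLIntegral_le_measure_mul_iSup [SFinite μ] [MeasurableSpace A] (μ' : Measure A) [SFinite μ'] (hSm : MeasurableSet S)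
    {f : G → ℝ≥0∞} (hF : Measurable fun p : A × G => f (τ p.1 * p.2)) :
    μ' S * ∫⁻ x in B, f x ∂μ ≤ μ B * ⨆ x ∈ B, ∫⁻ a in S, f (τ a * x) ∂μ' := by
  rw [measure_mul_setLIntegral_eq_setLIntegral_setLIntegral μ τ hBm hB μ' hSm hF]
  calc ∫⁻ x in B, ∫⁻ a in S, f (τ a * x) ∂μ' ∂μ ≤ ∫⁻ _ in B, (⨆ x ∈ B, ∫⁻ a in S, f (τ a * x) ∂μ') ∂μ :=
        setLIntegral_mono' hBm fun x hx => le_iSup₂ (f := fun x (_ : x ∈ B) => ∫⁻ a in S, f (τ a * x) ∂μ') x hx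
    _ = μ B * ⨆ x ∈ B, ∫⁻ a in S, f (τ a * x) ∂μ' := by rw [setLIntegral_const, mul_comm]

end Generic

/-! ## §2 The torus map `a ↦ t_a = diag(a, 1, σ(a)⁻¹) : Kˣ → ↥U(σ, Φ₃)(K)` and the near-collision event -/

section TorusMap
variable {K : Type*} [Field K] (σ : K →+* K) (hσ : ∀ x, σ (σ x) = x)

/-- `t_{ab} = t_a · t_b` (the torus map is a homomorphism). [cite: Rogawski1990, §1.10 p. 9] -/
theorem torusOne_mul (a b : Kˣ) :
    (⟨glDiagonal 3 K ![a * b, 1, (Units.map (σ : K →* K) (a * b))⁻¹], torusOne_mem_unitaryGroupOfForm σ hσ (a * b)⟩ :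
        ↥(unitaryGroupOfForm σ ((StdForm.antidiagonal 3).over K))) =
      ⟨glDiagonal 3 K ![a, 1, (Units.map (σ : K →* K) a)⁻¹], torusOne_mem_unitaryGroupOfForm σ hσ a⟩ *
        ⟨glDiagonal 3 K ![b, 1, (Units.map (σ : K →* K) b)⁻¹], torusOne_mem_unitaryGroupOfForm σ hσ b⟩ := by
  refine Subtype.ext ?_
  show glDiagonal 3 K ![a * b, 1, (Units.map (σ : K →* K) (a * b))⁻¹] =
    glDiagonal 3 K ![a, 1, (Units.map (σ : K →* K) a)⁻¹] * glDiagonal 3 K ![b, 1, (Units.map (σ : K →* K) b)⁻¹]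
  rw [← map_mul]
  congr 1
  funext i
  have h3 : ∀ k : Fin 3, k = 0 ∨ k = 1 ∨ k = 2 := by decide
  rcases h3 i with rfl | rfl | rfl
  · rfl
  · exact (mul_one 1).symm
  · show (Units.map (σ : K →* K) (a * b))⁻¹ = (Units.map (σ : K →* K) a)⁻¹ * (Units.map (σ : K →* K) b)⁻¹
    rw [map_mul, mul_inv]

variable [TopologicalSpace K] [IsTopologicalRing K] (hσc : Continuous σ)

include hσc in
/-- **`a ↦ t_a` is continuous** (`d ↦ diag(d)` is continuous, ★ `continuous_glDiagonal`; `a ↦ (σ a)⁻¹` is continuous on `Kˣ`). [cite: Rogawski1990, §1.10 p. 9] -/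
theorem continuous_torusOne :
    Continuous fun a : Kˣ => (⟨glDiagonal 3 K ![a, 1, (Units.map (σ : K →* K) a)⁻¹], torusOne_mem_unitaryGroupOfForm σ hσ a⟩ :
      ↥(unitaryGroupOfForm σ ((StdForm.antidiagonal 3).over K))) := by
  refine Continuous.subtype_mk ((continuous_glDiagonal (n := 3) K).comp (continuous_pi fun i => ?_)) _
  have h3 : ∀ k : Fin 3, k = 0 ∨ k = 1 ∨ k = 2 := by decide
  rcases h3 i with rfl | rfl | rfl
  · exact continuous_id
  · exact continuous_const
  · exact (Continuous.units_map (σ : K →* K) hσc).inv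

end TorusMap

section Entries
variable {K : Type*} [Field K] [TopologicalSpace K] (σ : K →+* K)

/-- The matrix entries `g ↦ g_ij` are continuous on `↥U`. [cite: Rogawski1990, §1.10 p. 9] -/
theorem continuous_apply_coe (i j : Fin 3) :
    Continuous fun g : ↥(unitaryGroupOfForm σ ((StdForm.antidiagonal 3).over K)) => ((g : GL (Fin 3) K) : Matrix (Fin 3) (Fin 3) K) i j :=
  (Units.continuous_val.comp continuous_subtype_val).matrix_elem i j

end Entries

section Event
variable {K : Type*} [Field K] [ValuativeRel K] [TopologicalSpace K] [IsNonarchimedeanLocalField K] (σ : K →+* K)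
  [MeasurableSpace ↥(unitaryGroupOfForm σ ((StdForm.antidiagonal 3).over K))] [BorelSpace ↥(unitaryGroupOfForm σ ((StdForm.antidiagonal 3).over K))]

/-- **THE NEAR-COLLISION EVENT IS MEASURABLE**: `{g ∈ U | ∃ i ≠ j, |g_ii − g_jj| ≤ ε}` is a finite union of closed sets (`‖·‖_K` and the entries are continuous).
[cite: HarishChandra1970, Part VII §2 p. 69] -/
theorem measurableSet_nearCollision (ε : ℝ≥0) :
    MeasurableSet {g : ↥(unitaryGroupOfForm σ ((StdForm.antidiagonal 3).over K)) | ∃ i j : Fin 3, i ≠ j ∧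
      normAbs K (((g : GL (Fin 3) K) : Matrix (Fin 3) (Fin 3) K) i i - ((g : GL (Fin 3) K) : Matrix (Fin 3) (Fin 3) K) j j) ≤ ε} := by
  have hset : {g : ↥(unitaryGroupOfForm σ ((StdForm.antidiagonal 3).over K)) | ∃ i j : Fin 3, i ≠ j ∧
      normAbs K (((g : GL (Fin 3) K) : Matrix (Fin 3) (Fin 3) K) i i - ((g : GL (Fin 3) K) : Matrix (Fin 3) (Fin 3) K) j j) ≤ ε} =
      ⋃ i : Fin 3, ⋃ j : Fin 3, {g : ↥(unitaryGroupOfForm σ ((StdForm.antidiagonal 3).over K)) | i ≠ j ∧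
        normAbs K (((g : GL (Fin 3) K) : Matrix (Fin 3) (Fin 3) K) i i - ((g : GL (Fin 3) K) : Matrix (Fin 3) (Fin 3) K) j j) ≤ ε} := by
    ext g; simp only [mem_setOf_eq, mem_iUnion]
  rw [hset]
  refine MeasurableSet.iUnion fun i => MeasurableSet.iUnion fun j => ?_
  by_cases hij : i = j
  · have he : {g : ↥(unitaryGroupOfForm σ ((StdForm.antidiagonal 3).over K)) | i ≠ j ∧
        normAbs K (((g : GL (Fin 3) K) : Matrix (Fin 3) (Fin 3) K) i i - ((g : GL (Fin 3) K) : Matrix (Fin 3) (Fin 3) K) j j) ≤ ε} = ∅ :=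
      eq_empty_of_forall_notMem fun g hg => hg.1 hij
    rw [he]; exact MeasurableSet.empty
  · have he : {g : ↥(unitaryGroupOfForm σ ((StdForm.antidiagonal 3).over K)) | i ≠ j ∧
        normAbs K (((g : GL (Fin 3) K) : Matrix (Fin 3) (Fin 3) K) i i - ((g : GL (Fin 3) K) : Matrix (Fin 3) (Fin 3) K) j j) ≤ ε} =
        {g : ↥(unitaryGroupOfForm σ ((StdForm.antidiagonal 3).over K)) |
          normAbs K (((g : GL (Fin 3) K) : Matrix (Fin 3) (Fin 3) K) i i - ((g : GL (Fin 3) K) : Matrix (Fin 3) (Fin 3) K) j j) ≤ ε} := by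
      ext g; exact ⟨fun h => h.2, fun h => ⟨hij, h⟩⟩
    rw [he]
    exact (isClosed_le (LocalFieldHaar.continuous_normAbs.comp ((continuous_apply_coe σ i i).sub (continuous_apply_coe σ j j)))
      continuous_const).measurableSet

end Event

/-! ## §3 Step (v): `μ'(𝒪^×) · μ(B ∩ NearColl_ε) ≤ μ(B) · sup_{g ∈ B} μ'{a ∈ 𝒪^× : t_a g collides} ≤ C · (ε∕ρ)^κ · μ'(𝒪^×) · μ(B)` -/

section StepV
variable {K : Type*} [Field K] [ValuativeRel K] [TopologicalSpace K] [IsNonarchimedeanLocalField K]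
  (σ : K →+* K) (hσ : ∀ x, σ (σ x) = x) (hσc : Continuous σ) (hσn : ∀ x, normAbs K (σ x) = normAbs K x)
  [MeasurableSpace Kˣ] [BorelSpace Kˣ] (μ' : Measure Kˣ) [SFinite μ']
  [MeasurableSpace ↥(unitaryGroupOfForm σ ((StdForm.antidiagonal 3).over K))] [BorelSpace ↥(unitaryGroupOfForm σ ((StdForm.antidiagonal 3).over K))]
  [SecondCountableTopology ↥(unitaryGroupOfForm σ ((StdForm.antidiagonal 3).over K))]
  (μ : Measure ↥(unitaryGroupOfForm σ ((StdForm.antidiagonal 3).over K))) [μ.IsMulLeftInvariant] [SFinite μ]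

include hσc in
/-- **STEP (v), PROFILE-FREE FORM**: for every measurable `B ⊆ U` invariant under the `𝒪^×`-torus (`t_a • B = B` for `valuation a = 1`) and every `ε`,
`μ'(𝒪^×) · μ(B ∩ NearColl_ε) ≤ μ(B) · sup_{g ∈ B} μ'{a ∈ 𝒪^× : ∃ i ≠ j, |(t_a g)_ii − (t_a g)_jj| ≤ ε}`. [cite: HarishChandra1970, Part VII §2 p. 69] [cite: WeilIntegration1965, §7] -/
theorem unitSphere_mul_measure_inter_nearCollision_le_iSup
    {B : Set ↥(unitaryGroupOfForm σ ((StdForm.antidiagonal 3).over K))} (hBm : MeasurableSet B)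
    (hB : ∀ a : Kˣ, valuation K (a : K) = 1 →
      (⟨glDiagonal 3 K ![a, 1, (Units.map (σ : K →* K) a)⁻¹], torusOne_mem_unitaryGroupOfForm σ hσ a⟩ :
        ↥(unitaryGroupOfForm σ ((StdForm.antidiagonal 3).over K))) • B = B) (ε : ℝ≥0) :
    μ' {a : Kˣ | valuation K (a : K) = 1} *
        μ (B ∩ {g | ∃ i j : Fin 3, i ≠ j ∧
          normAbs K (((g : GL (Fin 3) K) : Matrix (Fin 3) (Fin 3) K) i i - ((g : GL (Fin 3) K) : Matrix (Fin 3) (Fin 3) K) j j) ≤ ε}) ≤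
      μ B * ⨆ g ∈ B, μ' {a : Kˣ | valuation K (a : K) = 1 ∧ ∃ i j : Fin 3, i ≠ j ∧
        normAbs K
          (((((⟨glDiagonal 3 K ![a, 1, (Units.map (σ : K →* K) a)⁻¹], torusOne_mem_unitaryGroupOfForm σ hσ a⟩ :
                ↥(unitaryGroupOfForm σ ((StdForm.antidiagonal 3).over K))) * g :
                ↥(unitaryGroupOfForm σ ((StdForm.antidiagonal 3).over K))) : GL (Fin 3) K) : Matrix (Fin 3) (Fin 3) K) i i -
           ((((⟨glDiagonal 3 K ![a, 1, (Units.map (σ : K →* K) a)⁻¹], torusOne_mem_unitaryGroupOfForm σ hσ a⟩ :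
                ↥(unitaryGroupOfForm σ ((StdForm.antidiagonal 3).over K))) * g :
                ↥(unitaryGroupOfForm σ ((StdForm.antidiagonal 3).over K))) : GL (Fin 3) K) : Matrix (Fin 3) (Fin 3) K) j j) ≤ ε} := by
  haveI : IsTopologicalRing K := inferInstance
  -- names
  set τ : Kˣ → ↥(unitaryGroupOfForm σ ((StdForm.antidiagonal 3).over K)) :=
    fun a => ⟨glDiagonal 3 K ![a, 1, (Units.map (σ : K →* K) a)⁻¹], torusOne_mem_unitaryGroupOfForm σ hσ a⟩ with hτ
  set E : Set ↥(unitaryGroupOfForm σ ((StdForm.antidiagonal 3).over K)) := {g | ∃ i j : Fin 3, i ≠ j ∧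
    normAbs K (((g : GL (Fin 3) K) : Matrix (Fin 3) (Fin 3) K) i i - ((g : GL (Fin 3) K) : Matrix (Fin 3) (Fin 3) K) j j) ≤ ε} with hE
  set S : Set Kˣ := {a : Kˣ | valuation K (a : K) = 1} with hS
  have hEm : MeasurableSet E := measurableSet_nearCollision σ ε
  have hSm : MeasurableSet S := by
    have hS' : S = ((↑) : Kˣ → K) ⁻¹' {x | normAbs K x = 1} := by
      ext a; simp only [hS, mem_setOf_eq, mem_preimage, normAbs_eq_one_iff_valuation_eq_one]
    rw [hS']
    exact ((isClosed_eq LocalFieldHaar.continuous_normAbs continuous_const).preimage Units.continuous_val).measurableSet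
  have hτc : Continuous τ := continuous_torusOne σ hσ hσc
  have hm : Continuous fun p : Kˣ × ↥(unitaryGroupOfForm σ ((StdForm.antidiagonal 3).over K)) => τ p.1 * p.2 :=
    (hτc.comp continuous_fst).mul continuous_snd
  -- §1 with `f = 1_E`
  have hF : Measurable fun p : Kˣ × ↥(unitaryGroupOfForm σ ((StdForm.antidiagonal 3).over K)) => E.indicator (fun _ => (1 : ℝ≥0∞)) (τ p.1 * p.2) :=
    (measurable_const.indicator hEm).comp hm.measurable
  have key := measure_mul_setLIntegral_le_measure_mul_iSup μ τ hBm (fun a ha => hB a ha) μ' hSm hF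
  have hlhs : ∫⁻ x in B, E.indicator (fun _ => (1 : ℝ≥0∞)) x ∂μ = μ (B ∩ E) := by
    rw [lintegral_indicator_const hEm, Measure.restrict_apply hEm, one_mul, inter_comm]
  have hrhs : ∀ g, ∫⁻ a in S, E.indicator (fun _ => (1 : ℝ≥0∞)) (τ a * g) ∂μ' = μ' {a : Kˣ | valuation K (a : K) = 1 ∧ τ a * g ∈ E} := by
    intro g
    have hpre : MeasurableSet ((fun a => τ a * g) ⁻¹' E) := hEm.preimage (hτc.mul continuous_const).measurable
    have hind : (fun a => E.indicator (fun _ => (1 : ℝ≥0∞)) (τ a * g)) = ((fun a => τ a * g) ⁻¹' E).indicator (fun _ => (1 : ℝ≥0∞)) := by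
      funext a
      by_cases h : τ a * g ∈ E
      · rw [indicator_of_mem h, indicator_of_mem (show a ∈ (fun a => τ a * g) ⁻¹' E from h)]
      · rw [indicator_of_notMem h, indicator_of_notMem (show a ∉ (fun a => τ a * g) ⁻¹' E from h)]
    rw [hind, lintegral_indicator_const hpre, Measure.restrict_apply hpre, one_mul]
    congr 1
    ext a
    simp only [mem_inter_iff, mem_preimage, hS, mem_setOf_eq]
    exact and_comm
  rw [hlhs] at key
  exact key.trans (mul_le_mul' le_rfl (iSup₂_mono fun g _ => (hrhs g).le))

include hσc hσn in
/-- **STEP (v) OVER (FC-D)** (★ (FC-5) §5 `measure_diagCollision_unitary_le_of_unitsDigitFibre` inside the supremum): given (FC-D)'s conclusion `hD` at the ambient `K, σ, μ'`,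
there are `κ > 0` and `C ≠ ⊤` such that for every `ρ > 0`, every `ε`, and every measurable `𝒪^×`-torus-invariant `B ⊆ U` whose elements have `|g₀₀|, |g₁₁| ≥ ρ`:
`μ'(𝒪^×) · μ(B ∩ NearColl_ε) ≤ C · (ε∕ρ)^κ · μ'(𝒪^×) · μ(B)` — the line's «`μ(box_d ∩ {near-collision}) ≤ μ(box_d)·C_M·s_d^κ`» (R15-1)(v).
[cite: HarishChandra1970, Part VII §2 p. 69] [cite: Rogawski1990, §1.10 p. 9] -/
theorem measure_inter_nearCollision_le_of_unitsDigitFibre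
    (hD : ∃ κ : ℝ, 0 < κ ∧ ∃ C : ℝ≥0∞, C ≠ ⊤ ∧ ∀ r : ℝ≥0, r ≤ 1 → ∀ x y : K, normAbs K x = 1 →
      μ' {a : Kˣ | valuation K ↑a = 1 ∧ normAbs K (↑a * x - y) ≤ r} ≤ C * (r : ℝ≥0∞) ^ κ * μ' {a : Kˣ | valuation K ↑a = 1} ∧
      μ' {a : Kˣ | valuation K ↑a = 1 ∧ normAbs K (↑a * σ ↑a * x - y) ≤ r} ≤ C * (r : ℝ≥0∞) ^ κ * μ' {a : Kˣ | valuation K ↑a = 1}) :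
    ∃ κ : ℝ, 0 < κ ∧ ∃ C : ℝ≥0∞, C ≠ ⊤ ∧ ∀ ρ : ℝ≥0, 0 < ρ → ∀ ε : ℝ≥0,
      ∀ B : Set ↥(unitaryGroupOfForm σ ((StdForm.antidiagonal 3).over K)), MeasurableSet B →
        (∀ a : Kˣ, valuation K (a : K) = 1 →
          (⟨glDiagonal 3 K ![a, 1, (Units.map (σ : K →* K) a)⁻¹], torusOne_mem_unitaryGroupOfForm σ hσ a⟩ :
            ↥(unitaryGroupOfForm σ ((StdForm.antidiagonal 3).over K))) • B = B) →
        (∀ g ∈ B, ρ ≤ normAbs K (((g : GL (Fin 3) K) : Matrix (Fin 3) (Fin 3) K) 0 0) ∧ ρ ≤ normAbs K (((g : GL (Fin 3) K) : Matrix (Fin 3) (Fin 3) K) 1 1)) →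
        μ' {a : Kˣ | valuation K (a : K) = 1} *
            μ (B ∩ {g | ∃ i j : Fin 3, i ≠ j ∧
              normAbs K (((g : GL (Fin 3) K) : Matrix (Fin 3) (Fin 3) K) i i - ((g : GL (Fin 3) K) : Matrix (Fin 3) (Fin 3) K) j j) ≤ ε}) ≤
          C * ((ε / ρ : ℝ≥0) : ℝ≥0∞) ^ κ * μ' {a : Kˣ | valuation K (a : K) = 1} * μ B := by
  obtain ⟨κ, hκ, C, hC, h5⟩ := measure_diagCollision_unitary_le_of_unitsDigitFibre σ hσ hσn μ' hD
  refine ⟨κ, hκ, C, hC, fun ρ hρ ε B hBm hB hρB => ?_⟩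
  refine (unitSphere_mul_measure_inter_nearCollision_le_iSup σ hσ hσc μ' μ hBm hB ε).trans ?_
  rw [mul_comm (C * _ * _) (μ B)]
  refine mul_le_mul' le_rfl (iSup₂_le fun g hg => ?_)
  exact h5 ρ hρ ε g (hρB g hg).1 (hρB g hg).2

include hσc hσn in
/-- **STEP (v), CANCELLED FORM**: if moreover `0 < μ'(𝒪^×) < ⊤` (any Haar measure of `Kˣ`: the unit sphere is compact open), then for the same `κ`, `C`:
`μ(B ∩ NearColl_ε) ≤ C · (ε∕ρ)^κ · μ(B)`. [cite: HarishChandra1970, Part VII §2 p. 69] [cite: Rogawski1990, §1.10 p. 9] -/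
theorem measure_inter_nearCollision_le_of_unitsDigitFibre' (hS0 : μ' {a : Kˣ | valuation K (a : K) = 1} ≠ 0) (hS : μ' {a : Kˣ | valuation K (a : K) = 1} ≠ ⊤)
    (hD : ∃ κ : ℝ, 0 < κ ∧ ∃ C : ℝ≥0∞, C ≠ ⊤ ∧ ∀ r : ℝ≥0, r ≤ 1 → ∀ x y : K, normAbs K x = 1 →
      μ' {a : Kˣ | valuation K ↑a = 1 ∧ normAbs K (↑a * x - y) ≤ r} ≤ C * (r : ℝ≥0∞) ^ κ * μ' {a : Kˣ | valuation K ↑a = 1} ∧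
      μ' {a : Kˣ | valuation K ↑a = 1 ∧ normAbs K (↑a * σ ↑a * x - y) ≤ r} ≤ C * (r : ℝ≥0∞) ^ κ * μ' {a : Kˣ | valuation K ↑a = 1}) :
    ∃ κ : ℝ, 0 < κ ∧ ∃ C : ℝ≥0∞, C ≠ ⊤ ∧ ∀ ρ : ℝ≥0, 0 < ρ → ∀ ε : ℝ≥0,
      ∀ B : Set ↥(unitaryGroupOfForm σ ((StdForm.antidiagonal 3).over K)), MeasurableSet B →
        (∀ a : Kˣ, valuation K (a : K) = 1 →
          (⟨glDiagonal 3 K ![a, 1, (Units.map (σ : K →* K) a)⁻¹], torusOne_mem_unitaryGroupOfForm σ hσ a⟩ :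
            ↥(unitaryGroupOfForm σ ((StdForm.antidiagonal 3).over K))) • B = B) →
        (∀ g ∈ B, ρ ≤ normAbs K (((g : GL (Fin 3) K) : Matrix (Fin 3) (Fin 3) K) 0 0) ∧ ρ ≤ normAbs K (((g : GL (Fin 3) K) : Matrix (Fin 3) (Fin 3) K) 1 1)) →
        μ (B ∩ {g | ∃ i j : Fin 3, i ≠ j ∧
            normAbs K (((g : GL (Fin 3) K) : Matrix (Fin 3) (Fin 3) K) i i - ((g : GL (Fin 3) K) : Matrix (Fin 3) (Fin 3) K) j j) ≤ ε}) ≤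
          C * ((ε / ρ : ℝ≥0) : ℝ≥0∞) ^ κ * μ B := by
  obtain ⟨κ, hκ, C, hC, h⟩ := measure_inter_nearCollision_le_of_unitsDigitFibre σ hσ hσc hσn μ' μ hD
  refine ⟨κ, hκ, C, hC, fun ρ hρ ε B hBm hB hρB => ?_⟩
  have key := h ρ hρ ε B hBm hB hρB
  rw [mul_comm (C * _) (μ' _), mul_assoc (μ' _)] at key
  exact (ENNReal.mul_le_mul_iff_right hS0 hS).1 key

end StepV

end Summit.HodgeConjecture.HodgeConjecture.Cruxes.H413.K2E3TorusOneAveraging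

end
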